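import Summits.NavierStokesRegularity.NavierStokesRegularity.Theorems.AxisTwistDoorAveragedConeLiouvilleNUWeakEnergyPointwise
import HarnessLib

/-!
# N4 / T1 piece W1a (conclusion): the time-weighted energy inequality of a LIPSCHITZ generalized
# supersolution, `∫ c H''(V)|∇V|²Θ² ≤ ∫ c' H(V)Θ² − ∫ c H'(V)⟪∇V,∇Θ²⟫ − ∫ c Θ² H'(V)⟪b,∇V⟫`

Route `AxisTwistDoor`, crux `AveragedConeLiouville` (stmt-NavierStokesRegularity-26889), INPUT N4 / T1,
programme `kits/N4-T1-skeleton.lean` (118454bf17607d1e), brick W1a of `kits/N4-T1-W1-handoff.md`: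
`nu_weakEnergy_timeWeighted` — the admissible test `−H'(V)Θ²c` (`exists_lipschitzWith_test`) in the
typed weak inequality, the integrand computed a.e. (`nu_weak_integrand_ae`), the four pieces
integrable (`nu_weak_pieces_bound`, `nu_weak_pieces_aesm`, finite measure), the time term
integrated by parts (`time_ibp_on_cylinder`).

WHAT THIS IS NOT: not a statement about Navier–Stokes; T1 is an INPUT; item 26889 and the summit
stay open. [cite: NazarovUraltseva2011HarnackDivFree, §1 p. 2–3, §3 (3.2) (arXiv:1011.1888 p. 8)]
-/

noncomputable section

-- the summit and its single sub-problem share the name (CONVENTIONS §1)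
set_option linter.dupNamespace false

open MeasureTheory Set Function Filter Topology Metric
open scoped NNReal ENNReal InnerProductSpace RealInnerProductSpace

namespace Summit.NavierStokesRegularity.NavierStokesRegularity.Theorems.AveragedConeLiouville.NUPositivity

/-- **W1a: the time-weighted energy inequality of a Lipschitz generalized supersolution**
(module docstring; `kits/N4-T1-W1-handoff.md`): for `V` Lipschitz and nonnegative-agnostic on the
cylinder `]0,T[ × B(0,1)`, `b` measurable and bounded, the typed weak supersolution clause, `H ∈ C²`
with `H' ≤ 0`, a `C¹` compactly supported `Θ` with `tsupport Θ ⊆ B(0,ρ₀)`, `ρ₀ < 1`, and a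
nonnegative Lipschitz time weight `c` vanishing on `]-∞,τ₀] ∪ [T₀,∞[`, `0 < τ₀`, `T₀ < T`.
[cite: NazarovUraltseva2011HarnackDivFree, §1 p. 2–3, §3 (3.2) (arXiv:1011.1888 p. 8)] -/
theorem nu_weakEnergy_timeWeighted {T : ℝ} {V : ℝ → EuclideanSpace ℝ (Fin 3) → ℝ}
    {b : ℝ → EuclideanSpace ℝ (Fin 3) → EuclideanSpace ℝ (Fin 3)}
    (hbm : Measurable (uncurry b))
    (hbΛ : ∃ Λ : ℝ, ∀ t ∈ Ioo 0 T, ∀ x ∈ ball (0 : EuclideanSpace ℝ (Fin 3)) 1, ‖b t x‖ ≤ Λ)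
    (hVlip : ∃ L, LipschitzOnWith L (uncurry V) (Ioo 0 T ×ˢ ball (0 : EuclideanSpace ℝ (Fin 3)) 1))
    (hweak : ∀ η : ℝ → EuclideanSpace ℝ (Fin 3) → ℝ, (∃ K, LipschitzWith K (uncurry η)) →
        (∀ t x, 0 ≤ η t x) →
        (∃ ρ τ : ℝ, ρ < 1 ∧ 0 < τ ∧ ∀ t x, (ρ ≤ ‖x‖ ∨ t ≤ τ) → η t x = 0) →
        0 ≤ ∫ p in Ioo 0 T ×ˢ ball (0 : EuclideanSpace ℝ (Fin 3)) 1,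
          (deriv (fun s => V s p.2) p.1 * η p.1 p.2 +
            ⟪gradient (V p.1) p.2, gradient (η p.1) p.2⟫ +
            ⟪b p.1 p.2, gradient (V p.1) p.2⟫ * η p.1 p.2))
    {H : ℝ → ℝ} (hH : ContDiff ℝ 2 H) (hH' : ∀ v, deriv H v ≤ 0)
    {Θ : EuclideanSpace ℝ (Fin 3) → ℝ} (hΘ : ContDiff ℝ 1 Θ) (hΘc : HasCompactSupport Θ) {ρ₀ : ℝ}
    (hρ₀ : ρ₀ < 1) (hΘρ : tsupport Θ ⊆ ball (0 : EuclideanSpace ℝ (Fin 3)) ρ₀)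
    {c : ℝ → ℝ} {Kc : ℝ≥0} (hc : LipschitzWith Kc c) (hc0 : ∀ t, 0 ≤ c t) {τ₀ T₀ : ℝ}
    (hτ₀ : 0 < τ₀) (hT₀ : T₀ < T) (hcτ : ∀ t, t ≤ τ₀ → c t = 0) (hcT : ∀ t, T₀ ≤ t → c t = 0) :
    (∫ p in Ioo 0 T ×ˢ ball (0 : EuclideanSpace ℝ (Fin 3)) 1,
        c p.1 * (deriv (deriv H) (V p.1 p.2) * ‖gradient (V p.1) p.2‖ ^ 2 * Θ p.2 ^ 2)) ≤
      (∫ p in Ioo 0 T ×ˢ ball (0 : EuclideanSpace ℝ (Fin 3)) 1,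
          deriv c p.1 * (H (V p.1 p.2) * Θ p.2 ^ 2)) -
        (∫ p in Ioo 0 T ×ˢ ball (0 : EuclideanSpace ℝ (Fin 3)) 1,
          c p.1 * (deriv H (V p.1 p.2) *
            ⟪gradient (V p.1) p.2, gradient (fun y => Θ y ^ 2) p.2⟫)) -
        (∫ p in Ioo 0 T ×ˢ ball (0 : EuclideanSpace ℝ (Fin 3)) 1,
          c p.1 * (Θ p.2 ^ 2 * (deriv H (V p.1 p.2) * ⟪b p.1 p.2, gradient (V p.1) p.2⟫))) := by
  obtain ⟨Λ, hΛ⟩ := hbΛ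
  obtain ⟨L, hL⟩ := hVlip
  obtain ⟨g, hg, hVg⟩ := hL.extend_real
  have hH1 : ContDiff ℝ 1 (deriv H) := by
    have h2 : ContDiff ℝ (1 + 1) H := by rw [one_add_one_eq_two]; exact hH
    exact h2.deriv'
  -- the ingredients, stated on the cylinder
  have hB := time_ibp_on_cylinder hg hVg hH hΘ hΘc hρ₀ hΘρ hc hτ₀ hT₀ hcτ hcT
  obtain ⟨C, hC⟩ := nu_weak_pieces_bound hΛ hg hVg hH hΘ hΘc hc.continuous
  obtain ⟨hm₁, hm₂, hm₃, hm₄⟩ := nu_weak_pieces_aesm hbm hg hVg hH hΘ hc.continuous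
  have hident := nu_weak_integrand_ae b hg hVg hH hΘ c
  -- the admissible test `η₀ = −H'(g)Θ²c` and the weak inequality
  obtain ⟨Kη, hKη⟩ := exists_lipschitzWith_test hg hH1 hΘ hΘc hΘρ hc hcτ hcT
  have hη₀0 : ∀ t x, 0 ≤ -deriv H (g (t, x)) * (Θ x ^ 2 * c t) := fun t x =>
    mul_nonneg (neg_nonneg.mpr (hH' _)) (mul_nonneg (sq_nonneg _) (hc0 t))
  have hη₀van : ∃ ρ τ : ℝ, ρ < 1 ∧ 0 < τ ∧ ∀ t (x : EuclideanSpace ℝ (Fin 3)),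
      (ρ ≤ ‖x‖ ∨ t ≤ τ) → -deriv H (g (t, x)) * (Θ x ^ 2 * c t) = 0 := by
    refine ⟨ρ₀, τ₀, hρ₀, hτ₀, fun t x h => ?_⟩
    rcases h with h | h
    · have : Θ x = 0 := image_eq_zero_of_notMem_tsupport fun h' => by
        have := hΘρ h'; rw [mem_ball_zero_iff] at this; linarith
      rw [this]; ring
    · rw [hcτ t h]; ring
  have hw := hweak (fun t x => -deriv H (g (t, x)) * (Θ x ^ 2 * c t)) ⟨Kη, hKη⟩ hη₀0 hη₀van
  -- the cylinder as a finite-measure set; integrability of the four pieces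
  set W : Set (ℝ × EuclideanSpace ℝ (Fin 3)) := Ioo 0 T ×ˢ ball (0 : EuclideanSpace ℝ (Fin 3)) 1 with hW
  have hWopen : IsOpen W := isOpen_Ioo.prod isOpen_ball
  have hWm : MeasurableSet W := hWopen.measurableSet
  have hWfin : volume W < ∞ :=
    (measure_mono (Set.prod_mono Ioo_subset_Icc_self ball_subset_closedBall)).trans_lt
      ((isCompact_Icc.prod (isCompact_closedBall (0 : EuclideanSpace ℝ (Fin 3)) 1)).measure_lt_top)
  haveI : (volume : Measure (ℝ × EuclideanSpace ℝ (Fin 3))).IsAddHaarMeasure := by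
    change ((volume : Measure ℝ).prod (volume : Measure (EuclideanSpace ℝ (Fin 3)))).IsAddHaarMeasure
    infer_instance
  have hae : ∀ᵐ p ∂(volume.restrict W), p ∈ W ∧ DifferentiableAt ℝ g p :=
    (ae_restrict_mem hWm).and (ae_restrict_of_ae (hg.ae_differentiableAt (μ := volume)))
  have hKint : Integrable (fun _ : ℝ × EuclideanSpace ℝ (Fin 3) => C) (volume.restrict W) :=
    integrableOn_const hWfin.ne
  have hI₁ : Integrable (fun p : ℝ × EuclideanSpace ℝ (Fin 3) =>
      c p.1 * (deriv (fun s => H (V s p.2)) p.1 * Θ p.2 ^ 2)) (volume.restrict W) :=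
    hKint.mono' hm₁ (by
      filter_upwards [hae] with p hp
      rw [Real.norm_eq_abs]; exact (hC p hp.1 hp.2).1)
  have hI₂ : Integrable (fun p : ℝ × EuclideanSpace ℝ (Fin 3) =>
      c p.1 * (deriv (deriv H) (V p.1 p.2) * ‖gradient (V p.1) p.2‖ ^ 2 * Θ p.2 ^ 2))
      (volume.restrict W) :=
    hKint.mono' hm₂ (by
      filter_upwards [hae] with p hp
      rw [Real.norm_eq_abs]; exact (hC p hp.1 hp.2).2.1)
  have hI₃ : Integrable (fun p : ℝ × EuclideanSpace ℝ (Fin 3) =>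
      c p.1 * (deriv H (V p.1 p.2) * ⟪gradient (V p.1) p.2, gradient (fun y => Θ y ^ 2) p.2⟫))
      (volume.restrict W) :=
    hKint.mono' hm₃ (by
      filter_upwards [hae] with p hp
      rw [Real.norm_eq_abs]; exact (hC p hp.1 hp.2).2.2.1)
  have hI₄ : Integrable (fun p : ℝ × EuclideanSpace ℝ (Fin 3) =>
      c p.1 * (Θ p.2 ^ 2 * (deriv H (V p.1 p.2) * ⟪b p.1 p.2, gradient (V p.1) p.2⟫)))
      (volume.restrict W) :=
    hKint.mono' hm₄ (by
      filter_upwards [hae] with p hp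
      rw [Real.norm_eq_abs]; exact (hC p hp.1 hp.2).2.2.2)
  have hI₁₂ : Integrable (fun p : ℝ × EuclideanSpace ℝ (Fin 3) =>
      c p.1 * (deriv (fun s => H (V s p.2)) p.1 * Θ p.2 ^ 2) +
        c p.1 * (deriv (deriv H) (V p.1 p.2) * ‖gradient (V p.1) p.2‖ ^ 2 * Θ p.2 ^ 2))
      (volume.restrict W) := hI₁.add hI₂
  have hI₁₂₃ : Integrable (fun p : ℝ × EuclideanSpace ℝ (Fin 3) =>
      c p.1 * (deriv (fun s => H (V s p.2)) p.1 * Θ p.2 ^ 2) +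
        c p.1 * (deriv (deriv H) (V p.1 p.2) * ‖gradient (V p.1) p.2‖ ^ 2 * Θ p.2 ^ 2) +
        c p.1 * (deriv H (V p.1 p.2) * ⟪gradient (V p.1) p.2, gradient (fun y => Θ y ^ 2) p.2⟫))
      (volume.restrict W) := hI₁₂.add hI₃
  -- split the tested inequality and integrate the time term by parts
  have h0 := hw.trans_eq (integral_congr_ae hident)
  rw [integral_neg, integral_add hI₁₂₃ hI₄, integral_add hI₁₂ hI₃, integral_add hI₁ hI₂, hB] at h0
  linarith

end Summit.NavierStokesRegularity.NavierStokesRegularity.Theorems.AveragedConeLiouville.NUPositivity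

end
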